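import Summits.Ventures.LatticeQCDFlow.Scaling.ClockConditionedPairRates
import Summits.Ventures.LatticeQCDFlow.Scaling.WeightedPathCouplingPairRates

/-!
HONEST FRAMING: exact (Metropolis-corrected) sampling algorithms for lattice gauge theory; figures
of merit are autocorrelation/cost numbers at stated couplings and volumes; no continuum-physics
claim.

# ClockConditionedEdgeRates — THE SHARP STEP LOGARITHM FROM PER-EDGE, PER-ATTEMPT-COUNT CONTRACTION DATA: FILES 4 AND 5 COMPOSED (lean-2 GEN-43, ours)

Venture-side (OURS).  Cell `lqcd-flow` (pub-lqcd), unit `pub-lqcd-lean-2-g43`, 2026-08-31.  Chapter AC, file 6 — the interface the remaining steps of the C2 ∕ C4 assembly have to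
meet.  `A, B ≥ 0` with unit row sums, `0 ≤ σ < 1`, `S = σA + (1−σ)B`, the powers `Sⁿ, Aⁿ` and the cycle kernels `C_j = AʲB` by their recursions, a stationary probability vector `π`;
an edge relation `E` with edge lengths `ℓ ≥ 1` and the path pseudo-metric `d` of W17 (`hle`, `happrox`) with `d ≤ D`; ON EVERY EDGE and for every attempt count `j` a coupling `θ`
of `C_j(a,·), C_j(b,·)` with `E_θ d ≤ (1 − r_j(a,b))·ℓ(a,b)`, `−q ≤ r_j(a,b) ≤ 1`, and the discounted mean `Σ_{j<n}σʲ(1−σ)(1−r_j(a,b)) ≤ 1 − r̃` for every `n` (`0 < r̃ ≤ 1`).  Then,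
with `ε = (1−σ)(r̃/2)/(8(2+2q))`:

* **`clock_worstTvDist_le_edgeRates`**: `d_S(n) ≤ (4D/r̃)·((1+ε)⁻¹)ⁿ`;
* **`clock_mixingTime_le_edgeRates`**: `t_mix^S(ε₀) ≤ N` for every natural `N ≥ (−log ε₀ + log(4D/r̃))/log(1+ε)`.

(File 5 turns the edge data into pair rates with `q' = 2q+1`, `r̃' = r̃/2`; file 4 is applied to those.)  For the lumped star: `E` = adjacent equal-hub pairs, `ℓ = Ψ` on edges,
`C_j(x,·)` determined by the `j`-attempt hub law, and the edge data = the per-`j` product bracket of the σ-mixture certificate (memo MEMO-gen43 §3).  Literature grade (cell rule): OWN,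
plumbing; nothing cited; no new bib keys.
-/

open Finset
open Literature.Probability.MarkovChains

namespace Summit.Ventures.LatticeQCDFlow.Scaling

section EdgeRates
variable {X : Type*} [Fintype X] [DecidableEq X]
variable {A B S : X → X → ℝ} {σ : ℝ} {Sn An C : ℕ → X → X → ℝ} {E : X → X → Prop} {ℓ d : X → X → ℝ} {re : ℕ → X → X → ℝ} {D rt q : ℝ}

/-- **`d_S(n) ≤ (4D/r̃)·((1+ε)⁻¹)ⁿ` from per-edge per-attempt-count contraction data**, `ε = (1−σ)(r̃/2)/(8(1+(2q+1)))` (see the module docstring). [ours] -/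
theorem clock_worstTvDist_le_edgeRates (hA0 : ∀ x y, 0 ≤ A x y) (hA1 : ∀ x, ∑ y, A x y = 1) (hB0 : ∀ x y, 0 ≤ B x y) (hB1 : ∀ x, ∑ y, B x y = 1)
    (hσ0 : 0 ≤ σ) (hσ1 : σ < 1) (hS : ∀ x y, S x y = σ * A x y + (1 - σ) * B x y)
    (hSn0 : ∀ x y, Sn 0 x y = if x = y then 1 else 0) (hSns : ∀ n x y, Sn (n + 1) x y = ∑ z, S x z * Sn n z y)
    (hAn0 : ∀ x y, An 0 x y = if x = y then 1 else 0) (hAns : ∀ n x y, An (n + 1) x y = ∑ z, A x z * An n z y)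
    (hC0 : ∀ x y, C 0 x y = B x y) (hCs : ∀ j x y, C (j + 1) x y = ∑ z, A x z * C j z y)
    (hℓ1 : ∀ a b, E a b → 1 ≤ ℓ a b)
    (hle : ∀ x y L, IsGraphPath E ℓ x y L → d x y ≤ L) (happrox : ∀ x y ε, 0 < ε → ∃ L, IsGraphPath E ℓ x y L ∧ L ≤ d x y + ε) (hdD : ∀ x y, d x y ≤ D)
    (hrt0 : 0 < rt) (hrt1 : rt ≤ 1) (hq : 0 ≤ q)
    (hedge : ∀ j a b, E a b → ∃ θ, IsCoupling (C j a) (C j b) θ ∧ transportCost d θ ≤ (1 - re j a b) * ℓ a b)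
    (hrq : ∀ j a b, E a b → -q ≤ re j a b) (hr1 : ∀ j a b, E a b → re j a b ≤ 1)
    (hmean : ∀ n a b, E a b → ∑ j ∈ range n, σ ^ j * (1 - σ) * (1 - re j a b) ≤ 1 - rt)
    {π : X → ℝ} (hπ0 : ∀ x, 0 ≤ π x) (hπ1 : ∑ x, π x = 1) (hπS : IsStationary π S)
    {ε : ℝ} (hε : ε = (1 - σ) * (rt / 2) / (8 * (1 + (2 * q + 1)))) (n : ℕ) :
    worstTvDist S π n ≤ 2 * D / (rt / 2) * ((1 + ε)⁻¹) ^ n := by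
  classical
  have hC : ∀ j, IsRowStochastic (C j) := clock_cycle_rowStochastic hA0 hA1 hB0 hB1 hC0 hCs
  have hℓ : ∀ a b, E a b → 0 ≤ ℓ a b := fun a b h => zero_le_one.trans (hℓ1 a b h)
  obtain ⟨r, hcontr, hrq', hr1', hmean'⟩ := wpathRates_exists (P := C) hC hℓ1 hle happrox hrt0 hrt1 hq hedge hrq hr1 hmean
  have hdd : ∀ x, d x x = 0 := wpath_self hℓ hle happrox
  have hd1 : ∀ x y, x ≠ y → 1 ≤ d x y := fun x y hxy => wpath_ge_one hℓ1 happrox hxy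
  exact clock_worstTvDist_le_pairRates hA0 hA1 hB0 hB1 hσ0 hσ1 hS hSn0 hSns hAn0 hAns hC0 hCs hdd hd1 hdD
    (by linarith : (0:ℝ) ≤ 2 * q + 1) hrq' hr1' (by linarith : 0 < rt / 2) (by linarith : rt / 2 ≤ 1) hmean' hcontr hπ0 hπ1 hπS hε n

/-- **THE SHARP STEP LOGARITHM FROM PER-EDGE PER-ATTEMPT-COUNT CONTRACTION DATA:** `t_mix^S(ε₀) ≤ N` for every natural `N ≥ (−log ε₀ + log(2D/(r̃/2)))/log(1+ε)`,
`ε = (1−σ)(r̃/2)/(8(1+(2q+1)))` (see the module docstring). [ours] -/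
theorem clock_mixingTime_le_edgeRates (hA0 : ∀ x y, 0 ≤ A x y) (hA1 : ∀ x, ∑ y, A x y = 1) (hB0 : ∀ x y, 0 ≤ B x y) (hB1 : ∀ x, ∑ y, B x y = 1)
    (hσ0 : 0 ≤ σ) (hσ1 : σ < 1) (hS : ∀ x y, S x y = σ * A x y + (1 - σ) * B x y)
    (hSn0 : ∀ x y, Sn 0 x y = if x = y then 1 else 0) (hSns : ∀ n x y, Sn (n + 1) x y = ∑ z, S x z * Sn n z y)
    (hAn0 : ∀ x y, An 0 x y = if x = y then 1 else 0) (hAns : ∀ n x y, An (n + 1) x y = ∑ z, A x z * An n z y)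
    (hC0 : ∀ x y, C 0 x y = B x y) (hCs : ∀ j x y, C (j + 1) x y = ∑ z, A x z * C j z y)
    (hℓ1 : ∀ a b, E a b → 1 ≤ ℓ a b)
    (hle : ∀ x y L, IsGraphPath E ℓ x y L → d x y ≤ L) (happrox : ∀ x y ε, 0 < ε → ∃ L, IsGraphPath E ℓ x y L ∧ L ≤ d x y + ε) (hdD : ∀ x y, d x y ≤ D)
    (hrt0 : 0 < rt) (hrt1 : rt ≤ 1) (hq : 0 ≤ q)
    (hedge : ∀ j a b, E a b → ∃ θ, IsCoupling (C j a) (C j b) θ ∧ transportCost d θ ≤ (1 - re j a b) * ℓ a b)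
    (hrq : ∀ j a b, E a b → -q ≤ re j a b) (hr1 : ∀ j a b, E a b → re j a b ≤ 1)
    (hmean : ∀ n a b, E a b → ∑ j ∈ range n, σ ^ j * (1 - σ) * (1 - re j a b) ≤ 1 - rt)
    {π : X → ℝ} (hπ0 : ∀ x, 0 ≤ π x) (hπ1 : ∑ x, π x = 1) (hπS : IsStationary π S)
    {ε : ℝ} (hε : ε = (1 - σ) * (rt / 2) / (8 * (1 + (2 * q + 1)))) {ε₀ : ℝ} (hε₀ : 0 < ε₀) {N : ℕ}
    (hN : (-Real.log ε₀ + Real.log (2 * D / (rt / 2))) / Real.log (1 + ε) ≤ N) :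
    mixingTime S π ε₀ ≤ N := by
  classical
  have hC : ∀ j, IsRowStochastic (C j) := clock_cycle_rowStochastic hA0 hA1 hB0 hB1 hC0 hCs
  have hℓ : ∀ a b, E a b → 0 ≤ ℓ a b := fun a b h => zero_le_one.trans (hℓ1 a b h)
  obtain ⟨r, hcontr, hrq', hr1', hmean'⟩ := wpathRates_exists (P := C) hC hℓ1 hle happrox hrt0 hrt1 hq hedge hrq hr1 hmean
  have hdd : ∀ x, d x x = 0 := wpath_self hℓ hle happrox
  have hd1 : ∀ x y, x ≠ y → 1 ≤ d x y := fun x y hxy => wpath_ge_one hℓ1 happrox hxy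
  exact clock_mixingTime_le_pairRates hA0 hA1 hB0 hB1 hσ0 hσ1 hS hSn0 hSns hAn0 hAns hC0 hCs hdd hd1 hdD
    (by linarith : (0:ℝ) ≤ 2 * q + 1) hrq' hr1' (by linarith : 0 < rt / 2) (by linarith : rt / 2 ≤ 1) hmean' hcontr hπ0 hπ1 hπS hε hε₀ hN

end EdgeRates

end Summit.Ventures.LatticeQCDFlow.Scaling
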